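import Summits.QuantumFields.YangMills.Theorems.BalabanUVNodesK0AllTorusOfStepTokensRFloor
import Summits.QuantumFields.YangMills.Theorems.BalabanUVNodesK0PrintCubeOfStepTokensR
import Literature.MathematicalPhysics.QuantumFieldTheory.Balaban1983to89.Node00.TorusCoverGaugeTokensRFloor

/-!
# K0⁷ — PART 2 RE-KEYED ON THE FLOOR: STUB 2′ FILLS THE FLOOR-CARRYING (9)-SUPPLIER SLOT, AND THE THREE-STUB COMPOSITION OF V20 OPTION R
# `record13SepCoPHBody_of_stubs1R_2P_3A'R : stub 1-R ∧ stub 2′ ∧ 3ᴬ′-R ⟹ K0⁷'s body on every family`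

Cell `pub-ymgap`, seat `pub-ymgap-k0-s1-w3` generation 7 (K0⁷ `stmt-QuantumFields-20541`, V19 stub 1 `stub_prop8StepCoP13` helper lane;
`--kind proof --supports stmt-QuantumFields-20541 --as helper`).  NEW leaf over the sibling `…K0AllTorusOfStepTokensRFloor` (PART 1-R), dag-n21-c's PART 2
(`…K0PrintCubeOfStepTokensR`, p591861: `floorP_mul_le_pow`) and dag-n07-e's module 48 (`Node00/TorusCoverGaugeTokensRFloor`, p623261: the (9)-token from the FLOOR-CARRYING top step
and [6] Prop. 6 on print's class, floor `max c₈ ((11·4 + 4ρ₀L)·L)`).  Theorems only (0 `def`, 0 `sorry`); nothing in the tree is modified.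

THE V20 OPTION-R TEXTS (lane owner dag-n07-e's `V20-STUB1-TEXT-PROPOSAL.md`, 2026-08-28; NOT registered here — the plan words and registers):
* stub 1-R  `∃ (c : ℕ) (B₃ a₀ a₁ : ℝ), 2·(F.L)² ≤ B₃ ∧ 0 < a₀ ∧ 0 < a₁ ∧ Prop8RegSepTopStepR F 2 suppDom c B₃ a₀ a₁` (floor `c ≤ ν.M₁` ∃-bound OUTERMOST; module 46);
* stub 2′   UNCHANGED (V19: [6] Prop. 6 on print's cube class at SOME big-block size `ρ₀ ≥ 1`; landed BY NAME, k0-s2-w1 p595104);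
* 3ᴬ′-R     V19's 3ᴬ′ with the FIRST antecedent `VariationalThm1RegSepCoP7MR F 2 c B₃ a₀ a₁` (module 49) at the SAME `c` as its (9)-antecedent `Gauge9RegSepTopStepR … (L^j) c …`.
§1 fills PART 1-R's generic R-supplier slot from stub 2′: at floor `c` and bare size `ρ₀` the (9)-token holds at the cube letter `L^j`, `j := ρ₀ + 3 + c`, floor `c′ := max c ((11·4 + 4ρ₀L)·L)`
(`c ≤ c′ ≤ L^j`: `c < L^c`, PART 2's `floorP_mul_le_pow`), constants `b9OfP·B₃`, ceiling `min a₁ (a0OfP∕B₃)`.  §2 is the composition the V20-R skeleton's `Record13SepCoPHInhabited_of` can cite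
BY NAME (`:= record13SepCoPHBody_of_stubs1R_2P_3A'R h1R h2P h3A'R`; `K0HBodyAt` unfolds by `rfl`).  §3 displays that V19's stub-1 text still feeds it (floor `0`).

HONEST FRAMING: count-neutral kernel bookkeeping BY NAME; CONDITIONAL compositions whose antecedents are OPEN (stub 1-R = N07's [15] Prop. 8 ∕ Sect. F at objects with print's floor,
stub 2′ = N05's [6] Prop. 6 on print's cubes, 3ᴬ′-R = NODE O, print-STATED [I] §1 p.264 with unpublished proof [II] p.355); nothing of Bałaban asserted; a skeleton re-text is NOT progress
by itself; `stub_prop8StepCoP13` ∕ K0⁷ ∕ K1⁹ NOT closed; N07 NOT discharged; counts unmoved (typed 28∕28 · discharged 5∕27); the route closes only the conditional finite-𝕋⁴ rung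
`BalabanLadder.UV` — the YM mass gap (Clay) is NOT proved by any of this; nothing continuum ∕ ℝ⁴ ∕ OS.  No `sorry`, `def`, `instance`, `notation`.
[15] = Bałaban, CMP 102 (1985) 277–309 [Balaban1985Variational]; [6] = CMP 99 (1985) 75 [Balaban1985RegularSpaces]; [III] = CMP 119 (1988) 243 [Balaban1988Convergent];
[I] = CMP 109 (1987) 249 [Balaban1987RG1]; [II] = CMP 122 (1989) 355 [Balaban1989LargeFieldII].
-/

noncomputable section

open scoped Matrix.Norms.L2Operator

namespace Summit.QuantumFields.YangMills.Theorems.K0PrintCubeOfStepTokensRFloor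

open Literature.MathematicalPhysics.QuantumFieldTheory.Balaban1983to89
open Literature.MathematicalPhysics.QuantumFieldTheory.Balaban1983to89.Node00
open Literature.MathematicalPhysics.QuantumFieldTheory.Balaban1983to89.T4Continuum
open Literature.MathematicalPhysics.QuantumFieldTheory.Balaban1983to89.FlowStep
open Literature.MathematicalPhysics.QuantumFieldTheory.Balaban1983to89.B8LeafModelZd (ZdIdx)
open Summit.QuantumFields.YangMills.Theorems.K0PrintCubeOfStepTokensR (floorP_mul_le_pow)
open Summit.QuantumFields.YangMills.Theorems.K0AllTorusOfStepTokensRFloor (record13SepCoPHBody_of_stub1R_of_gauge9SupplierR_of_absBetaBoxAtR prop8StepCoPR_of_prop8StepCoP)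

/-! ## §1  Stub 2′ fills PART 1-R's floor-carrying (9)-supplier slot -/

section Supplier

variable (F : T4Family)

/-- **THE TWO FLOORS FIT UNDER THE CUBE LETTER `L^(ρ₀+3+c)`**: `max c ((11·4 + 4·(ρ₀·L))·L) ≤ L^(ρ₀+3+c)` for `1 ≤ ρ₀` (`c < L^c`; PART 2's `floorP_mul_le_pow`). A2ʷ's collar reading
`c′ ≤ M₁ = L^j` at the index the composition picks. [cite: Balaban1985RegularSpaces, (1.130) p.99, p.98 (bookkeeping); Balaban1985Variational, (144) p.300, p.304 lines 1–2] -/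
theorem max_floor_le_pow {ρ₀ : ℕ} (hρ₀ : 1 ≤ ρ₀) (c : ℕ) : max c ((11 * 4 + 4 * (ρ₀ * F.L)) * F.L) ≤ F.L ^ (ρ₀ + 3 + c) := by
  have hL1 : 1 < F.L := F.hL.2
  have hL0 : 0 < F.L := by omega
  refine max_le ?_ ?_
  · exact (Nat.lt_pow_self hL1).le.trans (Nat.pow_le_pow_right hL0 (by omega))
  · exact (floorP_mul_le_pow F hρ₀).trans (Nat.pow_le_pow_right hL0 (by omega))

/-- **STUB 2′ AT `F` FILLS PART 1-R's FLOOR-CARRYING (9)-SUPPLIER SLOT AT `F`**: from [6] Prop. 6 on print's cube class at big-block size `ρ₀ ≥ 1` (`zdCubP (MatA 2) L ρ₀`, constants `0 ≤ B₁`,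
`0 < c₁`), for every floor `c` and guarded `(B₃, a₀, a₁)` carrying [15] Prop. 8's FLOOR-CARRYING top step at floor `c`, the floor-carrying (9)-token holds at the cube letter `L^j`,
`j := ρ₀ + 3 + c`, at the floor `c′ := max c ((11·4 + 4·(ρ₀·L))·L)` (`c ≤ c′ ≤ L^j`), with `B₉ = b9OfP·B₃` and the shrunk ceiling `a₁′ = min a₁ (a0OfP∕B₃)` — dag-n07-e's module 48
`gauge9RP_of_prop8TopStepR_of_prop6P_of_one_le` BY NAME at `M := L^j`, Prop. 8's ceiling shrunk by `.of_le`.  CONDITIONAL.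
[cite: Balaban1985Variational, Thm 1 (8)–(10) p.279, (144)–(152) pp.300–301, Prop. 8 p.304, p.304 lines 1–2; Balaban1985RegularSpaces, Prop. 6 p.99, p.98] -/
theorem gauge9SupplierR_of_prop6MemberP
    (h2P : ∃ (ρ₀ : ℕ) (B₁ c₁ : ℝ), 1 ≤ ρ₀ ∧ 0 ≤ B₁ ∧ 0 < c₁ ∧
      (letI : CStarAlgebra (MatA 2) := {}; B8.Prop6Printed 4 (F.L : ℝ) B₁ c₁ (fun i : ZdIdx 4 F.L => zdCubP (MatA 2) F.L ρ₀ i)))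
    (c : ℕ) (B₃ a₀ a₁ : ℝ) (hB₃ : 2 * (F.L : ℝ) ^ 2 ≤ B₃) (_ha₀ : 0 < a₀) (ha₁ : 0 < a₁)
    (h8 : Prop8RegSepTopStepR F 2 (fun ν K Ω => suppDomOfRecord F ν K Ω) c B₃ a₀ a₁) :
    ∃ (j c' : ℕ) (B₉ a₁' : ℝ), c ≤ c' ∧ c' ≤ F.L ^ j ∧ 0 < B₉ ∧ 0 < a₁' ∧ a₁' ≤ a₁ ∧
      Gauge9RegSepTopStepR F 2 (fun ν K Ω => suppDomOfRecord F ν K Ω) (F.L ^ j) c' B₃ B₉ a₀ a₁' := by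
  obtain ⟨ρ₀, B₁, c₁, hρ₀, hB₁, hc₁, hP6⟩ := h2P
  have hL : (0 : ℝ) < (F.L : ℝ) := by exact_mod_cast lt_trans Nat.zero_lt_one F.hL.2
  have hBpos : (0 : ℝ) < B₃ := lt_of_lt_of_le (mul_pos two_pos (pow_pos hL 2)) hB₃
  set M : ℕ := F.L ^ (ρ₀ + 3 + c) with hM
  have ha0P : 0 < a0OfP F 2 M (ρ₀ * F.L) B₁ c₁ := a0OfP_pos (F := F) (N := 2) M (ρ₀ * F.L) hB₁ hc₁
  have ha₁' : 0 < min a₁ (a0OfP F 2 M (ρ₀ * F.L) B₁ c₁ / B₃) := lt_min ha₁ (div_pos ha0P hBpos)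
  have hle : B₃ * min a₁ (a0OfP F 2 M (ρ₀ * F.L) B₁ c₁ / B₃) ≤ a0OfP F 2 M (ρ₀ * F.L) B₁ c₁ :=
    calc B₃ * min a₁ (a0OfP F 2 M (ρ₀ * F.L) B₁ c₁ / B₃) ≤ B₃ * (a0OfP F 2 M (ρ₀ * F.L) B₁ c₁ / B₃) :=
          mul_le_mul_of_nonneg_left (min_le_right _ _) hBpos.le
      _ = a0OfP F 2 M (ρ₀ * F.L) B₁ c₁ := mul_div_cancel₀ _ hBpos.ne'
  exact ⟨ρ₀ + 3 + c, max c ((11 * 4 + 4 * (ρ₀ * F.L)) * F.L), b9OfP F M (ρ₀ * F.L) B₁ * B₃, min a₁ (a0OfP F 2 M (ρ₀ * F.L) B₁ c₁ / B₃),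
    le_max_left _ _, max_floor_le_pow F hρ₀ c, mul_pos (b9OfP_pos (F := F) M (ρ₀ * F.L) hB₁) hBpos, ha₁', min_le_left _ _,
    gauge9RP_of_prop8TopStepR_of_prop6P_of_one_le (h8.of_le le_rfl (min_le_left _ _)) hB₁ hc₁ hρ₀ hP6 M hBpos hle⟩

end Supplier

/-! ## §2  ★★★ The V20 option-R composition: stub 1-R ∧ stub 2′ ∧ 3ᴬ′-R ⟹ K0⁷'s body on every family -/

section Composition

/-- **★★★ K0⁷'s BODY AT EVERY FAMILY FROM STUB 1-R, STUB 2′ AND 3ᴬ′-R** — `h1R` = the V20 option-R stub-1 text VERBATIM ([15] Prop. 8's top step at the record's support selector for SOME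
floor `c` and guarded `(B₃, a₀, a₁)`; `Prop8RegSepTopStepR`, module 46); `h2P` = STUB 2′ VERBATIM (V19: [6] Prop. 6 on PRINT's cube class at SOME big-block size `ρ₀ ≥ 1`); `h3A'R` = 3ᴬ′-R
(the sign-free β-box of A1's witness `θ₁₅ᶜᶜᴹ(j)` on some window, for every cube letter `(j, c)` with `c ≤ L^j` and every guarded tuple carrying the FLOOR-CARRYING (8) at floor `c` and the
(9)-token at `(L^j, c)`).  Proof: §1 fills PART 1-R's supplier slot at `(L^(ρ₀+3+c), max c ((44 + 4ρ₀L)·L))`, then `record13SepCoPHBody_of_stub1R_of_gauge9SupplierR_of_absBetaBoxAtR`.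
The shape the V20-R skeleton's `Record13SepCoPHInhabited_of h1R h2P h3A'R` cites BY NAME.  CONDITIONAL; K0⁷ NOT closed here; nothing of Bałaban asserted; a re-text is not progress.
[cite: Balaban1985Variational, Thm 1 (8)–(9) p.279, (144)–(152) pp.300–301, Prop. 8 p.304, p.304 lines 1–2; Balaban1985RegularSpaces, (1.3)–(1.6) p.77, Prop. 6 p.99, p.98; Balaban1988Convergent, Thm 1 p.262, (2.6)–(2.8) pp.255–256, p.257; Balaban1987RG1, Thm 1 p.259, §1 p.264] -/
theorem record13SepCoPHBody_of_stubs1R_2P_3A'R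
    (h1R : ∀ F : T4Family, ∃ (c : ℕ) (B₃ a₀ a₁ : ℝ), 2 * (F.L : ℝ) ^ 2 ≤ B₃ ∧ 0 < a₀ ∧ 0 < a₁ ∧
      Prop8RegSepTopStepR F 2 (fun ν K Ω => suppDomOfRecord F ν K Ω) c B₃ a₀ a₁)
    (h2P : ∀ F : T4Family, ∃ (ρ₀ : ℕ) (B₁ c₁ : ℝ), 1 ≤ ρ₀ ∧ 0 ≤ B₁ ∧ 0 < c₁ ∧
      (letI : CStarAlgebra (MatA 2) := {}; B8.Prop6Printed 4 (F.L : ℝ) B₁ c₁ (fun i : ZdIdx 4 F.L => zdCubP (MatA 2) F.L ρ₀ i)))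
    (h3A'R : ∀ (F : T4Family) (j c : ℕ) (B₃ B₃' a₀ a₁ : ℝ), c ≤ F.L ^ j → 2 * (F.L : ℝ) ^ 2 ≤ B₃ → 0 < B₃' → 0 < a₀ → 0 < a₁ →
      VariationalThm1RegSepCoP7MR F 2 c B₃ a₀ a₁ →
      Gauge9RegSepTopStepR F 2 (fun ν K Ω => suppDomOfRecord F ν K Ω) (F.L ^ j) c B₃ B₃' a₀ a₁ →
      ∃ γ₀ ε₀ ε₂₉ β' : ℝ, 0 < γ₀ ∧ 0 < ε₀ ∧ 0 < ε₂₉ ∧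
        BetaLowerH (-β') γ₀ (betaOfRecord₁₃ F 2 (theta13OfThm1CCM F 2 j ε₀ ε₂₉ B₃ B₃' a₀ a₁)) ∧
        BetaUpperH β' γ₀ (betaOfRecord₁₃ F 2 (theta13OfThm1CCM F 2 j ε₀ ε₂₉ B₃ B₃' a₀ a₁))) :
    ∀ F : T4Family, ∃ θ : Stage13HParams F 2, θ.Provisos₁₃SepCoPH F 2 ∧ (θ.ZhUnity F 2 ∧ θ.SlotsNondegenerate₁₃ F 2) ∧ θ.Admissible F 2 :=
  record13SepCoPHBody_of_stub1R_of_gauge9SupplierR_of_absBetaBoxAtR h1R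
    (fun F c B₃ a₀ a₁ hB₃ ha₀ ha₁ h8 => gauge9SupplierR_of_prop6MemberP F (h2P F) c B₃ a₀ a₁ hB₃ ha₀ ha₁ h8) h3A'R

end Composition

/-! ## §3  Sanity: V19's stub 1 still feeds the R composition (floor `0`) -/

section Direction

/-- **V19's STUB 1 ∧ STUB 2′ ∧ 3ᴬ′-R ⟹ K0⁷'s BODY** (V19's floor-free stub 1 is V20-R's stub 1 at floor `0`, sibling `prop8StepCoPR_of_prop8StepCoP`) — so a by-name proof of V19's
stub 1 still lands after the re-text; the only stub whose text got STRONGER is 3ᴬ′ (sibling `absBetaBoxAtGen_of_absBetaBoxAtGenR`).  CONDITIONAL; displayed, not a registration.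
[cite: Balaban1985Variational, Prop. 8 p.304, p.304 lines 1–2 (bookkeeping); Balaban1985RegularSpaces, Prop. 6 p.99; Balaban1987RG1, §1 p.264] -/
theorem record13SepCoPHBody_of_stubs1_2P_3A'R
    (h1 : ∀ F : T4Family, ∃ B₃ a₀ a₁ : ℝ, 2 * (F.L : ℝ) ^ 2 ≤ B₃ ∧ 0 < a₀ ∧ 0 < a₁ ∧
      Prop8RegSepTopStep F 2 (fun ν K Ω => suppDomOfRecord F ν K Ω) B₃ a₀ a₁)
    (h2P : ∀ F : T4Family, ∃ (ρ₀ : ℕ) (B₁ c₁ : ℝ), 1 ≤ ρ₀ ∧ 0 ≤ B₁ ∧ 0 < c₁ ∧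
      (letI : CStarAlgebra (MatA 2) := {}; B8.Prop6Printed 4 (F.L : ℝ) B₁ c₁ (fun i : ZdIdx 4 F.L => zdCubP (MatA 2) F.L ρ₀ i)))
    (h3A'R : ∀ (F : T4Family) (j c : ℕ) (B₃ B₃' a₀ a₁ : ℝ), c ≤ F.L ^ j → 2 * (F.L : ℝ) ^ 2 ≤ B₃ → 0 < B₃' → 0 < a₀ → 0 < a₁ →
      VariationalThm1RegSepCoP7MR F 2 c B₃ a₀ a₁ →
      Gauge9RegSepTopStepR F 2 (fun ν K Ω => suppDomOfRecord F ν K Ω) (F.L ^ j) c B₃ B₃' a₀ a₁ →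
      ∃ γ₀ ε₀ ε₂₉ β' : ℝ, 0 < γ₀ ∧ 0 < ε₀ ∧ 0 < ε₂₉ ∧
        BetaLowerH (-β') γ₀ (betaOfRecord₁₃ F 2 (theta13OfThm1CCM F 2 j ε₀ ε₂₉ B₃ B₃' a₀ a₁)) ∧
        BetaUpperH β' γ₀ (betaOfRecord₁₃ F 2 (theta13OfThm1CCM F 2 j ε₀ ε₂₉ B₃ B₃' a₀ a₁))) :
    ∀ F : T4Family, ∃ θ : Stage13HParams F 2, θ.Provisos₁₃SepCoPH F 2 ∧ (θ.ZhUnity F 2 ∧ θ.SlotsNondegenerate₁₃ F 2) ∧ θ.Admissible F 2 :=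
  record13SepCoPHBody_of_stubs1R_2P_3A'R (fun F => prop8StepCoPR_of_prop8StepCoP F (h1 F)) h2P h3A'R

end Direction

end Summit.QuantumFields.YangMills.Theorems.K0PrintCubeOfStepTokensRFloor

end
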